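import Summits.BirchSwinnertonDyer.Rank1Residual.O5.CharTwistThreeIsometry
import Summits.BirchSwinnertonDyer.Rank1Residual.O5.CongruenceNumberTwist
import Literature.NumberTheory.EllipticCurves.RootNumberTwistProofs
import Literature.NumberTheory.EllipticCurves.LFunctionSmulProofs
import HarnessLib

/-!
# O5 (`9 ∣ N`): the CONGRUENCE NUMBER is invariant under the quadratic twist by `(−3/·)` — TWIN

HONEST FRAMING (cell `b2b-bsdres`, run/shared/lean/b2b/bsd-rank1-residual/, verbatim in every
file): the goal of the cell is to DELETE the COMBINATION-SHAPED residual classes of the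
Birch–Swinnerton-Dyer formula for ALL analytic-rank `≤ 1` elliptic curves over `ℚ` — assembled
STRICTLY from published theorems — so that the rank-`≤ 1` remainder becomes exactly the
CONSTRUCTION-SHAPED classes, which are TYPED, NOT attempted. This is not "finishing BSD". Lane
CLASS-CLOSURE, team o5 (additive potentially good reduction at `3`, `9 ∥ N`); planner o5-r2 GEN 7's
ask (G7-2)/N2 'TWIN' (`HOME/b2b-bsdres-o5-r2/gen7/TWIN-PROOF.md`, EVIDENCE 40/40 twin pairs in census
CONG3); prover seat `b2b-bsdres-x11b3-p5` (gen. 7, cross-cell pool). THEOREMS ONLY (no definition,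
no named fact, no `sorry`); nothing booked; no RESIDUAL-MAP mark / label / count moved; O5 OPEN.
UNCONDITIONAL kernel theorems about the tree's ARS congruence number
(`Literature/…/CongruenceNumber.lean`, [AgasheRibetStein2012] §2.1 (ii)) and the tree's Shimura
twist (`Literature/…/CuspFormTwist.lean`); nothing is asserted about the E-O5-CONG law
(`O5/CongruenceDefectLawAtNine.lean`, a conjecture node, untouched) or about any census row.

## The theorem

**TWIN (`congruenceNumber_charTwist`).** Let `9 ∣ N`, `χ = (−3/·)` the primitive quadratic
character mod `3`, and `f ∈ S_k(Γ₀(N))` ANY cusp form (any weight) that is `3`-DEPLETED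
(`aₙ(f) = 0` whenever `3 ∣ n`). Then the twist `f ⊗ χ = charTwist N _ _ _ f ∈ S_k(Γ₀(N))`
(`aₙ(f ⊗ χ) = χ(n) aₙ(f)`) has the SAME congruence number:
`congruenceNumber (f ⊗ χ) = congruenceNumber f`, where
`congruenceNumber g = #(S_k(Γ₀(N); ℤ) ⧸ (ℤg + (ℤg)^⊥))` (ARS (ii)). EVERY newform of level `N` with
`9 ∣ N` is `3`-depleted (`a₃ = 0`; `congruenceNumber_charTwist_of_isNewform0`), so this covers
o5-r2's `3`-primitive newforms (Kodaira `III`/`III*` twins, where `f ⊗ χ` is the twin NEWFORM of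
level `N`) and also the `I₀*`/`Iₙ*` newforms (where `f ⊗ χ` is an oldform at level `N`). No
integrality, newform or non-vanishing hypothesis on `f` is needed, and NO newform theory is used
(the planner's sketch via Atkin–Lehner decomposition + strong multiplicity one is replaced by the
Petersson ISOMETRY `⟨f ⊗ χ, x ⊗ χ⟩ = ⟨f, x⟩` of `O5/CharTwistThreeIsometry.lean`).

Proof: with `R = (· ⊗ χ)` and `S = S_k(Γ₀(N); ℤ)`: `R` is `ℤ`-linear `S → S`
(`charTwist_mem_integralCuspForms0`), maps `ℤf + (ℤf)^⊥` into `ℤ Rf + (ℤ Rf)^⊥` (isometry ⇒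
orthogonality transport, `charTwist_mem_sup`), and `x − R(R x) ∈ (ℤf)^⊥` for every `x ∈ S`
(`sub_charTwist_charTwist_mem_sup`; `R(R f) = f`). Hence the induced map
`S/(ℤf + (ℤf)^⊥) → S/(ℤRf + (ℤRf)^⊥)` is injective (if `R x ∈ ℤRf + (ℤRf)^⊥` then
`R R x ∈ ℤf + (ℤf)^⊥`, so `x = (x − RRx) + RRx ∈ ℤf + (ℤf)^⊥`) and surjective (`[y] = [R(R y)]`), a
bijection — so the two `Nat.card`s agree (no finiteness or cyclicity of the quotient is needed).

COROLLARY READING for O5 (o5-r2 GEN 7 (G7-2), NOT formalised here, inputs NOT in this file): for an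
optimal `E` of Kodaira type `III` at `3`, `9 ∥ N`, and `E′` the optimal curve of its `(−3)`-twist class
(type `III*`, conductor `N`), `r_E = r_{E′}` by TWIN (their newforms are `3`-depleted twins); with
Watkins' `V₃ = 3` and ARS Thm. 2.1 this gives `e₃(E) = e₃(E′) + 1 + 2 ord₃(c_{E′}/c_E)` — the planner's
type-`III` multiplicity-one failure. Those inputs (Watkins 2002 §2.1; ARS Thm. 2.1; Manin constants)
are the o5 cell's facts / records, not touched here.

References: [AgasheRibetStein2012] §2.1; [Shimura1971] Prop. 3.64; [DiamondShurman2005] Prop. 5.5.2(a);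
cell files `HOME/b2b-bsdres-o5-r2/gen7/{O5-GEN7.md, TWIN-PROOF.md}`, TARGETS §O5.
-/

noncomputable section

open scoped MatrixGroups ModularForm ComplexConjugate

open Matrix.SpecialLinearGroup Matrix.GeneralLinearGroup UpperHalfPlane Complex
  CongruenceSubgroup Literature.NumberTheory.EllipticCurves.ModularForms
  Literature.NumberTheory.Automorphic

namespace Summit.BirchSwinnertonDyer.Rank1Residual.O5

variable {N : ℕ} [NeZero N] {k : ℤ} (h9 : 3 ^ 2 ∣ N) {χ : DirichletCharacter ℂ 3}
  (hχ : χ.IsQuadratic)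

/-! ### §1 Transport of `ℤf + (ℤf)^⊥` under the twist -/

section Transport

/-- **`R` maps `ℤf + (ℤf)^⊥` into `ℤ Rf + (ℤ Rf)^⊥`** for a `3`-depleted `f` (`R` = the twist by
`(−3/·)`): `R(z f + b) = z Rf + R b` with `R b` integral and `⟨Rf, Rb⟩ = ⟨f, b⟩ = 0` (isometry).
[cite: AgasheRibetStein2012, §2.1] -/
theorem charTwist_mem_sup (hprim : χ.IsPrimitive) {f : CuspForm (Gamma0 N) k}
    (hf : ∀ n, 3 ∣ n → cuspCoeff f n = 0) {x : CuspForm (Gamma0 N) k}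
    (hx : x ∈ (ℤ ∙ f) ⊔ integralOrthogonal0 f) :
    charTwist N dvd_rfl h9 hχ x ∈
      (ℤ ∙ charTwist N dvd_rfl h9 hχ f) ⊔ integralOrthogonal0 (charTwist N dvd_rfl h9 hχ f) := by
  obtain ⟨a, ha, b, hb, rfl⟩ := Submodule.mem_sup.mp hx
  obtain ⟨z, rfl⟩ := Submodule.mem_span_singleton.mp ha
  rw [mem_integralOrthogonal0] at hb
  rw [charTwist_add h9 hχ hprim, charTwist_zsmul h9 hχ hprim]
  refine Submodule.add_mem _ (Submodule.mem_sup_left (Submodule.mem_span_singleton.mpr ⟨z, rfl⟩))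
    (Submodule.mem_sup_right ?_)
  rw [mem_integralOrthogonal0]
  exact ⟨charTwist_mem_integralCuspForms0 h9 hχ hprim hb.1,
    peterssonProduct_charTwist_charTwist_eq_zero h9 hχ hprim hf hb.2⟩

/-- **`x − R(R x) ∈ (ℤf)^⊥ ⊆ ℤf + (ℤf)^⊥`** for a `3`-depleted `f` and an integral `x` (the
`3`-divisible part of `x` is integral and orthogonal to `f`). [cite: AgasheRibetStein2012, §2.1] -/
theorem sub_charTwist_charTwist_mem_sup (hprim : χ.IsPrimitive) {f : CuspForm (Gamma0 N) k}
    (hf : ∀ n, 3 ∣ n → cuspCoeff f n = 0) {x : CuspForm (Gamma0 N) k}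
    (hx : x ∈ integralCuspForms0 N k) :
    x - charTwist N dvd_rfl h9 hχ (charTwist N dvd_rfl h9 hχ x) ∈ (ℤ ∙ f) ⊔ integralOrthogonal0 f := by
  refine Submodule.mem_sup_right ?_
  rw [mem_integralOrthogonal0]
  exact ⟨Submodule.sub_mem _ hx
      (charTwist_mem_integralCuspForms0 h9 hχ hprim (charTwist_mem_integralCuspForms0 h9 hχ hprim hx)),
    peterssonProduct_sub_charTwist_charTwist_eq_zero h9 hχ hprim hf x⟩

end Transport

/-! ### §2 TWIN -/

section TwinTheorem

/-- **TWIN — the congruence number is invariant under the twist by `(−3/·)` at level `9 ∣ N`:**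
for every `3`-depleted `f ∈ S_k(Γ₀(N))` (`aₙ(f) = 0` for `3 ∣ n`),
`congruenceNumber (f ⊗ χ) = congruenceNumber f` (ARS 2012 §2.1 (ii): `r_f = #(S(ℤ)/(ℤf + (ℤf)^⊥))`).
The twist induces mutually inverse bijections of the two quotients (`R² ≡ id` modulo `(ℤf)^⊥`,
`R(R f) = f`); no newform theory, no finiteness. Answers planner o5-r2 GEN 7's theorem-candidate
TWIN (N2) in the STRONGER depleted form. [cite: AgasheRibetStein2012, §2.1]
[cite: Shimura1971, Prop. 3.64] -/
theorem congruenceNumber_charTwist (hprim : χ.IsPrimitive) {f : CuspForm (Gamma0 N) k}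
    (hf : ∀ n, 3 ∣ n → cuspCoeff f n = 0) :
    congruenceNumber (charTwist N dvd_rfl h9 hχ f) = congruenceNumber f := by
  set S := integralCuspForms0 N k with hS
  have hRf : ∀ n, 3 ∣ n → cuspCoeff (charTwist N dvd_rfl h9 hχ f) n = 0 :=
    fun n hn ↦ cuspCoeff_charTwist_eq_zero_of_dvd h9 hχ hprim f hn
  -- the twist as a `ℤ`-linear endomorphism of `S_k(Γ₀(N); ℤ)`
  let φ : S →ₗ[ℤ] S :=
    { toFun := fun x ↦ ⟨charTwist N dvd_rfl h9 hχ x, charTwist_mem_integralCuspForms0 h9 hχ hprim x.2⟩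
      map_add' := fun x y ↦ Subtype.ext (charTwist_add h9 hχ hprim (x : CuspForm (Gamma0 N) k) y)
      map_smul' := fun z x ↦ Subtype.ext (charTwist_zsmul h9 hχ hprim z (x : CuspForm (Gamma0 N) k)) }
  have hφ : ∀ x : S, ((φ x : S) : CuspForm (Gamma0 N) k) = charTwist N dvd_rfl h9 hχ x := fun _ ↦ rfl
  -- the two submodules `ℤg + (ℤg)^⊥` traced on `S`
  set Hf : Submodule ℤ S := ((ℤ ∙ f) ⊔ integralOrthogonal0 f).comap S.subtype with hHf
  set Hg : Submodule ℤ S := ((ℤ ∙ charTwist N dvd_rfl h9 hχ f) ⊔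
    integralOrthogonal0 (charTwist N dvd_rfl h9 hχ f)).comap S.subtype with hHg
  have hle : Hf ≤ Hg.comap φ := by
    intro x hx
    rw [Submodule.mem_comap, hHg, Submodule.mem_comap, Submodule.subtype_apply, hφ]
    rw [hHf, Submodule.mem_comap, Submodule.subtype_apply] at hx
    exact charTwist_mem_sup h9 hχ hprim hf hx
  let ψ : (S ⧸ Hf) →ₗ[ℤ] (S ⧸ Hg) := Hf.mapQ Hg φ hle
  have hψ : ∀ x : S, ψ (Submodule.Quotient.mk x) = Submodule.Quotient.mk (φ x) := fun _ ↦ rfl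
  -- injective: `R x ∈ ℤRf + (ℤRf)^⊥ ⇒ R R x ∈ ℤf + (ℤf)^⊥ ⇒ x = (x - RRx) + RRx ∈ ℤf + (ℤf)^⊥`
  have hinj : Function.Injective ψ := by
    rw [← LinearMap.ker_eq_bot, LinearMap.ker_eq_bot']
    intro q hq
    obtain ⟨x, rfl⟩ := Submodule.Quotient.mk_surjective Hf q
    rw [hψ, Submodule.Quotient.mk_eq_zero, hHg, Submodule.mem_comap, Submodule.subtype_apply, hφ] at hq
    rw [Submodule.Quotient.mk_eq_zero, hHf, Submodule.mem_comap, Submodule.subtype_apply]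
    have h2 := charTwist_mem_sup h9 hχ hprim hRf hq
    rw [charTwist_charTwist h9 hχ hprim hf] at h2
    have h3 := sub_charTwist_charTwist_mem_sup h9 hχ hprim hf x.2
    simpa using Submodule.add_mem _ h3 h2
  -- surjective: `[y] = [R (R y)]`
  have hsurj : Function.Surjective ψ := by
    intro q
    obtain ⟨y, rfl⟩ := Submodule.Quotient.mk_surjective Hg q
    refine ⟨Submodule.Quotient.mk (φ y), ?_⟩
    rw [hψ, Submodule.Quotient.eq, hHg, Submodule.mem_comap, Submodule.subtype_apply]
    have h' := sub_charTwist_charTwist_mem_sup h9 hχ hprim hRf y.2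
    have := Submodule.neg_mem _ h'
    simpa [hφ, neg_sub] using this
  rw [congruenceNumber_def, congruenceNumber_def]
  exact (Nat.card_congr (Equiv.ofBijective ψ ⟨hinj, hsurj⟩)).symm

end TwinTheorem

/-! ### §3 Newforms of level `N` with `9 ∣ N` are `3`-depleted -/

section Newform

/-- A newform `f` of level `N` with `9 ∣ N` has `aₙ(f) = 0` for all `3 ∣ n`: `a₃ = 0` since
`3² ∣ N` (tree `IsNewform0.cuspCoeff_eq_zero_of_sq_dvd`) and `a_{3m} = a₃ aₘ` for `3 ∣ N`
(tree `IsNewform0.cuspCoeff_prime_mul`). [cite: AtkinLehner1970, Thm. 3] -/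
theorem cuspCoeff_eq_zero_of_three_dvd_of_isNewform0 (h9 : 3 ^ 2 ∣ N) {f : CuspForm (Gamma0 N) k}
    (hf : IsNewform0 f) {n : ℕ} (hn : 3 ∣ n) : cuspCoeff f n = 0 := by
  obtain ⟨m, rfl⟩ := hn
  have h3N : 3 ∣ N := (dvd_pow_self 3 two_ne_zero).trans h9
  rw [hf.cuspCoeff_prime_mul Nat.prime_three m, if_pos h3N, sub_zero,
    hf.cuspCoeff_eq_zero_of_sq_dvd Nat.prime_three h9, zero_mul]

/-- **TWIN for newforms**: for a newform `f` of level `N`, `9 ∣ N`,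
`congruenceNumber (f ⊗ (−3/·)) = congruenceNumber f`. For a `3`-primitive newform (o5-r2: Kodaira
`III`/`III*` at `3`) `f ⊗ χ` is the twin newform of level `N`; for the others it is an oldform at
level `N`. [cite: AgasheRibetStein2012, §2.1] [cite: Shimura1971, Prop. 3.64] -/
theorem congruenceNumber_charTwist_of_isNewform0 (hprim : χ.IsPrimitive) {f : CuspForm (Gamma0 N) k}
    (hf : IsNewform0 f) : congruenceNumber (charTwist N dvd_rfl h9 hχ f) = congruenceNumber f :=
  congruenceNumber_charTwist h9 hχ hprim fun _ hn ↦ cuspCoeff_eq_zero_of_three_dvd_of_isNewform0 h9 hf hn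

/-- **TWIN for the newform of an elliptic curve** (the ARS setting of `congruenceNumber`, e.g.
`D.f` of a modular parametrisation datum): if `f` is the newform of `W` at level `N` with `9 ∣ N`,
then `congruenceNumber (f ⊗ (−3/·)) = congruenceNumber f`. [cite: AgasheRibetStein2012, §2.1] -/
theorem congruenceNumber_charTwist_of_isNewformOf (hprim : χ.IsPrimitive) {W : WeierstrassCurve ℚ}
    {f : CuspForm (Gamma0 N) 2} (hf : IsNewformOf W f) :
    congruenceNumber (charTwist N dvd_rfl h9 hχ f) = congruenceNumber f :=
  congruenceNumber_charTwist_of_isNewform0 h9 hχ hprim hf.1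

end Newform

/-! ### §4 The twin of an elliptic curve: the `p = 3` instance of `O5.CongruenceNumberTwin` -/

section Twin

/-- **TWIN for parametrisation data — the `p = 3` INSTANCE of cc-typer-5's node
`O5.CongruenceNumberTwin` (o5-r2 GEN 7 N2), as a THEOREM and WITHOUT the conductor / minimality
binders:** if `W' ≅ W ⊗ χ_{−3}` (`C • W.quadraticTwist (pStarRat 3) = W'`) and `D`, `D'` are modular
parametrisation data of `W`, `W'` at the SAME level `N` with `9 ∣ N`, then
`congruenceNumber D'.f = congruenceNumber D.f`. Proof: `D'.f = D.f ⊗ (−3/·)` coefficientwise —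
for `3 ∤ n` by `aₙ(W ⊗ χ_{p*}) = (n/p) aₙ(W)` (tree `LFunction_quadraticTwist_pStar_apply`,
`LFunction_smul`) and `χ₃ = (·/3)` (`quadraticChar_ringHomComp_apply_natCast`); for `3 ∣ n` both
vanish (`a₃ = 0` for newforms of level `9 ∣ N`) — then `congruenceNumber_charTwist_of_isNewformOf`.
[cite: AgasheRibetStein2012, §2.1] [cite: Shimura1971, Prop. 3.64] -/
theorem congruenceNumber_twin_three {W W' : WeierstrassCurve ℚ} [W.IsElliptic] [W'.IsElliptic]
    (C : WeierstrassCurve.VariableChange ℚ) (hC : C • W.quadraticTwist (pStarRat 3) = W')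
    {N : ℕ} [NeZero N] (D : ModularParametrizationData W N) (D' : ModularParametrizationData W' N)
    (h9 : 3 ^ 2 ∣ N) : congruenceNumber D'.f = congruenceNumber D.f := by
  haveI : Fact (Nat.Prime 3) := ⟨Nat.prime_three⟩
  set χ : DirichletCharacter ℂ 3 := (quadraticChar (ZMod 3)).ringHomComp (Int.castRingHom ℂ) with hχdef
  have hχq : χ.IsQuadratic := isQuadratic_quadraticChar_ringHomComp 3
  have hprim : χ.IsPrimitive := isPrimitive_quadraticChar_ringHomComp 3 (by norm_num)
  haveI : (W.quadraticTwist (pStarRat 3)).IsElliptic :=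
    W.isElliptic_quadraticTwist (by rw [pStarRat_three]; norm_num)
  have hD' : D'.f = charTwist N dvd_rfl h9 hχq D.f := by
    refine eq_of_forall_cuspCoeff_eq_gamma0 fun n ↦ ?_
    rw [cuspCoeff_charTwist N _ h9 hχq hprim, hχdef, quadraticChar_ringHomComp_apply_natCast]
    by_cases hn : 3 ∣ n
    · rw [cuspCoeff_eq_zero_of_three_dvd_of_isNewform0 h9 D'.isNewformOf.1 hn,
        cuspCoeff_eq_zero_of_three_dvd_of_isNewform0 h9 D.isNewformOf.1 hn, mul_zero]
    · rw [D'.isNewformOf.2 n, D.isNewformOf.2 n, ← hC, WeierstrassCurve.LFunction_smul, pStarRat,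
        W.LFunction_quadraticTwist_pStar_apply (by norm_num) hn]
      push_cast
      ring
  rw [hD']
  exact congruenceNumber_charTwist_of_isNewformOf h9 hχq hprim D.isNewformOf

/-- The `p = 3` clause of the node `O5.CongruenceNumberTwin` with its binders VERBATIM (the
conductor and minimality hypotheses are not needed at `p = 3`). The node itself (`∀` odd `p`) stays
`@[conjecture]`: the translation argument of `O5/CharTwistThreeIsometry.lean` uses that
`[1, 1/3; 0, 1]` NORMALISES `Γ₀(N)` (`3 ∣ 24`), which fails for `p ≥ 5`. [cite: AgasheRibetStein2012, §2.1] -/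
theorem congruenceNumberTwin_three :
    ∀ (W W' : WeierstrassCurve ℚ) [W.IsElliptic] [W.IsGloballyMinimal] [W'.IsElliptic]
      [W'.IsGloballyMinimal] (C : WeierstrassCurve.VariableChange ℚ),
      C • W.quadraticTwist (pStarRat 3) = W' →
      ∀ (N : ℕ) [NeZero N] (D : ModularParametrizationData W N) (D' : ModularParametrizationData W' N),
        W.conductorNorm ℤ = N → W'.conductorNorm ℤ = N → 3 ^ 2 ∣ N →
          congruenceNumber D'.f = congruenceNumber D.f :=
  fun _ _ _ _ _ _ C hC _ _ D D' _ _ h9 ↦ congruenceNumber_twin_three C hC D D' h9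

end Twin

end Summit.BirchSwinnertonDyer.Rank1Residual.O5
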